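import Literature.AlgebraicGeometry.Morphisms.CechModuleBiproduct
import Literature.AlgebraicGeometry.HodgeTheory.AbelianVarietyCechH1StructureSheafEqDim
import Literature.AlgebraicGeometry.Motives.AbelianVarietyTangentSheafFree
import HarnessLib

/-!
# `Ȟ¹` of a free module of finite rank, and `dim_ℂ Ȟ¹(𝔘, 𝒯_A) = (dim A)²` for a complex abelian variety

Topics `AlgebraicGeometry/Morphisms` (generic part, namespace `Literature.AlgebraicGeometry.Morphisms`) and
`AlgebraicGeometry/HodgeTheory` (namespace `Literature.AlgebraicGeometry.HodgeTheory`, prefix `AbelianVariety.` as in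
★ `AbelianVarietyCechH1StructureSheafEqDim`).  THEOREMS ONLY: no definition, no named fact, no instance, no `sorry`.
Cell hodgecm-mathlib (D-0151), count-neutral capital for node E2 of `B-plan/F-census/SOCKETS-F.md` §4 (α) «EQUIDIM by
proof»: the TARGET SPACE of the Kodaira–Spencer map of first-order deformations of an abelian variety,
`Def_A(k[ε]) → H¹(A, 𝒯_A) ≅ H¹(A, 𝒪_A) ⊗_k Lie A`, has dimension `g²` ([MumfordAV1970] §13 Cor. 2 «`dim H¹(A,𝒪_A) = g`»
⊗ §4 (iii) «`Ω¹_A` free of rank `g`»).  HC_CM is proved only modulo the 7 printed citations until rung 0 closes.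

Generic part (the Čech complex is an ADDITIVE functor of the sheaf — [StacksProject] Tag 01ED; [Hartshorne1977] III §4,
proof of Thm. 4.5, p. 222: `Ȟ¹` of `𝒪^I` computed summand by summand), on top of ★ `Morphisms/CechModuleBiproduct`
(which records only the VANISHING corollaries `subsingleton_cechMH1_biproduct/free`):

* `Morphisms.nonempty_cechMH1_linearEquiv_of_iso` — `M ≅ N ⇒ Ȟ¹(𝒰, M) ≃ₗ[A] Ȟ¹(𝒰, N)`;
* `Morphisms.nonempty_cechMH1_biproduct_linearEquiv` — **`Ȟ¹(𝒰, ⨁ⱼ Fⱼ) ≃ₗ[A] Πⱼ Ȟ¹(𝒰, Fⱼ)`** (`J` finite): `Ȟ¹(𝒰, –)`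
  PRESERVES finite biproducts (`x ↦ (Ȟ¹(πⱼ) x)ⱼ`, inverse `(yⱼ) ↦ ∑ⱼ Ȟ¹(ιⱼ) yⱼ`, by `∑ⱼ πⱼ ιⱼ = 𝟙` and `ιⱼ π_k = δ_{jk}`);
* `Morphisms.nonempty_cechMH1_free_linearEquiv`, `Morphisms.nonempty_cechMH1_linearEquiv_of_iso_free` —
  **`Ȟ¹(𝒰, P) ≃ₗ[A] (I → Ȟ¹(𝒰, 𝒪_X))`** for `P ≅ 𝒪_X^I`, `I` finite (`𝒪_X^I = free I ≅ ⨁_I 𝒪_X`, Mathlib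
  `biproduct.isoCoproduct`; `Ȟ¹(𝒰, 𝒪_X) = CechH1` of `Morphisms/CechH1` by ★ `CechMH1_unit`);
* `Morphisms.finrank_cechMH1_of_iso_free` — over a field: `finrank Ȟ¹(𝒰, P) = #I · finrank Ȟ¹(𝒰, 𝒪_X)`.

Abelian varieties over `ℂ` ([MumfordAV1970] §13 Cor. 2 with §4 (iii); Zariski–Čech form on EVERY finite affine open cover,
as in ★ `finrank_cechH1_structureSheaf_eq_dim`):

* `AbelianVariety.nonempty_cechMH1_tangentSheaf_linearEquiv` — `Ȟ¹(𝔘, 𝒯_A) ≃ₗ[ℂ] (Fin (dim A) → Ȟ¹(𝔘, 𝒪_A))` from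
  ★ `Motives.AbelianVariety.nonempty_tangentSheaf_iso_free` (`𝒯_A ≅ 𝒪_A^{dim A}`);
* **`AbelianVariety.finrank_cechMH1_tangentSheaf_eq_dim_sq`** — `Ȟ¹(𝔘, 𝒯_A)` is finite-dimensional of dimension
  `(dim A)²` for every finite affine open cover `𝔘` (★ `finrank_cechH1_structureSheaf_eq_dim`: `h¹(𝒪_A) = dim A`).

## References
* [MumfordAV1970] D. Mumford, *Abelian Varieties* (1970), §4 (iii) p. 42; §13 Cor. 2 p. 129.
* [Hartshorne1977] R. Hartshorne, *Algebraic Geometry*, GTM 52 (1977), III §4 Thm. 4.5 and its proof (p. 222).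
* [StacksProject] The Stacks project, Tag 01ED (Cohomology, Section 20.9: the Čech complex and its functoriality).
-/

set_option autoImplicit false

noncomputable section

open CategoryTheory AlgebraicGeometry Limits TopologicalSpace Opposite
open Literature.AlgebraicGeometry.Modules

universe u v w
namespace Literature.AlgebraicGeometry.Morphisms

variable {A : Type u} [CommRing A] {X : Scheme.{u}} (f : X ⟶ Spec (.of A)) {ι : Type v}
  (U : ι → X.Opens)

/-- **`Ȟ¹(𝒰, –)` is invariant under isomorphism, as an `A`-linear equivalence**: an isomorphism `e : M ≅ N` of
`𝒪_X`-modules induces `Ȟ¹(𝒰, M) ≃ₗ[A] Ȟ¹(𝒰, N)` (`Ȟ¹(e.hom)` with inverse `Ȟ¹(e.inv)`, functoriality of the Čech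
complex in the sheaf). [cite: StacksProject, Tag 01ED (Cohomology, Section 20.9)] -/
theorem nonempty_cechMH1_linearEquiv_of_iso {M N : X.Modules} (e : M ≅ N) :
    Nonempty (CechMH1 f M U ≃ₗ[A] CechMH1 f N U) :=
  ⟨LinearEquiv.ofLinear (cechMapH1 f e.hom U) (cechMapH1 f e.inv U)
    (LinearMap.ext fun x => by
      rw [LinearMap.comp_apply, ← cechMapH1_comp, e.inv_hom_id, cechMapH1_id_apply, LinearMap.id_apply])
    (LinearMap.ext fun x => by
      rw [LinearMap.comp_apply, ← cechMapH1_comp, e.hom_inv_id, cechMapH1_id_apply, LinearMap.id_apply])⟩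

/-- **`Ȟ¹(𝒰, –)` preserves finite biproducts**: for a finite family `F : J → Mod(𝒪_X)`,
`Ȟ¹(𝒰, ⨁ⱼ Fⱼ) ≃ₗ[A] Πⱼ Ȟ¹(𝒰, Fⱼ)`, `x ↦ (Ȟ¹(πⱼ) x)ⱼ` with inverse `(yⱼ) ↦ ∑ⱼ Ȟ¹(ιⱼ) yⱼ` — the Čech complex
is an additive functor of the sheaf (`Ȟ¹(∑ⱼ ιⱼ πⱼ) = ∑ⱼ Ȟ¹(πⱼ) ≫ Ȟ¹(ιⱼ)`, ★ `cechMapH1_sum_apply`, `biproduct.total`,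
`biproduct.ι_π`). [cite: StacksProject, Tag 01ED (Cohomology, Section 20.9)] [cite: Hartshorne1977, III §4 (p. 222)] -/
theorem nonempty_cechMH1_biproduct_linearEquiv {J : Type w} [Finite J] (F : J → X.Modules) [HasBiproduct F] :
    Nonempty (CechMH1 f (⨁ F) U ≃ₗ[A] ((j : J) → CechMH1 f (F j) U)) := by
  classical
  cases nonempty_fintype J
  let toF : CechMH1 f (⨁ F) U →ₗ[A] ((j : J) → CechMH1 f (F j) U) :=
    LinearMap.pi fun j => cechMapH1 f (biproduct.π F j) U
  let ofF : ((j : J) → CechMH1 f (F j) U) →ₗ[A] CechMH1 f (⨁ F) U :=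
    ∑ j, cechMapH1 f (biproduct.ι F j) U ∘ₗ LinearMap.proj j
  have htot : ∑ j, biproduct.π F j ≫ biproduct.ι F j = 𝟙 (⨁ F) :=
    Limits.IsBilimit.total (biproduct.isBilimit F)
  refine ⟨LinearEquiv.ofLinear toF ofF ?_ ?_⟩
  · -- `toF ∘ ofF = id`: `Ȟ¹(π_k)(∑ⱼ Ȟ¹(ιⱼ) yⱼ) = ∑ⱼ Ȟ¹(ιⱼ ≫ π_k) yⱼ = y_k`
    refine LinearMap.ext fun y => funext fun k => ?_
    simp only [toF, ofF, LinearMap.comp_apply, LinearMap.id_apply, LinearMap.pi_apply, LinearMap.sum_apply,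
      LinearMap.proj_apply]
    rw [map_sum]
    simp_rw [← cechMapH1_comp]
    rw [Finset.sum_eq_single k]
    · rw [biproduct.ι_π_self, cechMapH1_id_apply]
    · intro j _ hjk
      rw [biproduct.ι_π_ne F hjk, cechMapH1_zero]
    · intro hk
      exact absurd (Finset.mem_univ k) hk
  · -- `ofF ∘ toF = id`: `∑ⱼ Ȟ¹(ιⱼ)(Ȟ¹(πⱼ) x) = Ȟ¹(∑ⱼ πⱼ ≫ ιⱼ) x = x`
    refine LinearMap.ext fun x => ?_
    simp only [toF, ofF, LinearMap.comp_apply, LinearMap.id_apply, LinearMap.pi_apply, LinearMap.sum_apply,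
      LinearMap.proj_apply]
    simp_rw [← cechMapH1_comp]
    rw [← cechMapH1_sum_apply, htot, cechMapH1_id_apply]

/-- **`Ȟ¹(𝒰, 𝒪_X^I) ≃ₗ[A] (I → Ȟ¹(𝒰, 𝒪_X))`** for `I` finite (`𝒪_X^I = SheafOfModules.free I = ∐_I 𝒪_X ≅ ⨁_I 𝒪_X`,
Mathlib `biproduct.isoCoproduct`; `Ȟ¹(𝒰, 𝒪_X)` = the structure-sheaf `CechH1 f 𝒰` of `Morphisms/CechH1`, ★ `CechMH1_unit`).
[cite: StacksProject, Tag 01ED (Cohomology, Section 20.9)] [cite: Hartshorne1977, III §4 (p. 222)] -/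
theorem nonempty_cechMH1_free_linearEquiv (I : Type u) [Finite I] :
    Nonempty (CechMH1 f (SheafOfModules.free (R := X.ringCatSheaf) I) U ≃ₗ[A] (I → CechH1 f U)) := by
  haveI : HasFiniteBiproducts X.Modules := HasFiniteBiproducts.of_hasFiniteProducts
  let F : I → X.Modules := fun _ => SheafOfModules.unit X.ringCatSheaf
  -- `free I = ∐_I 𝒪_X ≅ ⨁_I 𝒪_X` (finite index type), in the category `X.Modules`
  have e₀ : (⨁ F) ≅ (SheafOfModules.free (R := X.ringCatSheaf) I : X.Modules) := biproduct.isoCoproduct F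
  obtain ⟨e₁⟩ := nonempty_cechMH1_linearEquiv_of_iso f U
    (M := (SheafOfModules.free (R := X.ringCatSheaf) I : X.Modules)) (N := ⨁ F) e₀.symm
  obtain ⟨e₂⟩ := nonempty_cechMH1_biproduct_linearEquiv f U F
  exact ⟨e₁.trans e₂⟩

/-- The same for a module isomorphic to `𝒪_X^I`, `I` finite: **`Ȟ¹(𝒰, P) ≃ₗ[A] (I → Ȟ¹(𝒰, 𝒪_X))`**.
[cite: StacksProject, Tag 01ED (Cohomology, Section 20.9)] [cite: Hartshorne1977, III §4 (p. 222)] -/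
theorem nonempty_cechMH1_linearEquiv_of_iso_free {P : X.Modules} {I : Type u} [Finite I]
    (e : P ≅ SheafOfModules.free (R := X.ringCatSheaf) I) :
    Nonempty (CechMH1 f P U ≃ₗ[A] (I → CechH1 f U)) := by
  obtain ⟨e₁⟩ := nonempty_cechMH1_linearEquiv_of_iso f U e
  obtain ⟨e₂⟩ := nonempty_cechMH1_free_linearEquiv f U I
  exact ⟨e₁.trans e₂⟩

/-- **Rank consequence over a field**: if `P ≅ 𝒪_X^I` (`I` finite) and `Ȟ¹(𝒰, 𝒪_X)` is finite-dimensional over a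
field `K`, then `Ȟ¹(𝒰, P)` is finite-dimensional with `finrank_K Ȟ¹(𝒰, P) = #I · finrank_K Ȟ¹(𝒰, 𝒪_X)`.
[cite: Hartshorne1977, III §4 (p. 222)] -/
theorem finrank_cechMH1_of_iso_free {K : Type u} [Field K] {Y : Scheme.{u}} (g : Y ⟶ Spec (.of K))
    (V : ι → Y.Opens) {P : Y.Modules} {I : Type u} [Finite I]
    (e : P ≅ SheafOfModules.free (R := Y.ringCatSheaf) I) [Module.Finite K (CechH1 g V)] :
    Module.Finite K (CechMH1 g P V) ∧
      Module.finrank K (CechMH1 g P V) = Nat.card I * Module.finrank K (CechH1 g V) := by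
  cases nonempty_fintype I
  haveI : Module.Free K (CechH1 g V) := Module.Free.of_divisionRing K _
  obtain ⟨φ⟩ := nonempty_cechMH1_linearEquiv_of_iso_free g V e
  refine ⟨Module.Finite.equiv φ.symm, ?_⟩
  rw [φ.finrank_eq, Module.finrank_pi_fintype, Finset.sum_const, Finset.card_univ, smul_eq_mul,
    Nat.card_eq_fintype_card]

end Literature.AlgebraicGeometry.Morphisms

namespace Literature.AlgebraicGeometry.HodgeTheory

open Literature.AlgebraicGeometry.Morphisms

/-- **`Ȟ¹(𝔘, 𝒯_A) ≃ₗ[ℂ] (Fin (dim A) → Ȟ¹(𝔘, 𝒪_A))`** for a complex abelian variety `A₀` and any family of opens `𝔘`: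
the tangent sheaf is free of rank `dim A` (★ `Motives.AbelianVariety.nonempty_tangentSheaf_iso_free`, [MumfordAV1970] §4 (iii))
and `Ȟ¹` is additive in the sheaf. [cite: MumfordAV1970, §4 (iii) (p. 42)] [cite: Hartshorne1977, III §4 (p. 222)] -/
theorem AbelianVariety.nonempty_cechMH1_tangentSheaf_linearEquiv
    (A₀ : Literature.AlgebraicGeometry.Motives.AbelianVariety ℂ) {κ : Type} (U : κ → A₀.X.left.Opens) :
    Nonempty (CechMH1 A₀.X.hom (tangentSheaf A₀.X) U ≃ₗ[ℂ] (Fin A₀.dim → CechH1 A₀.X.hom U)) := by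
  obtain ⟨e⟩ := Literature.AlgebraicGeometry.Motives.AbelianVariety.nonempty_tangentSheaf_iso_free A₀
  exact nonempty_cechMH1_linearEquiv_of_iso_free A₀.X.hom U e

/-- **`dim_ℂ Ȟ¹(𝔘, 𝒯_A) = (dim A)²` on every finite affine open cover** of a complex abelian variety `A₀` (and
`Ȟ¹(𝔘, 𝒯_A)` is finite-dimensional): `𝒯_A ≅ 𝒪_A^{dim A}` (★ `nonempty_tangentSheaf_iso_free`, [MumfordAV1970] §4 (iii)),
`Ȟ¹` of a free module of finite rank is computed summand by summand (`finrank_cechMH1_of_iso_free`), and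
`dim_ℂ Ȟ¹(𝔘, 𝒪_A) = dim A` on every finite affine open cover (★ `finrank_cechH1_structureSheaf_eq_dim`, [MumfordAV1970]
§13 Cor. 2) — i.e. `h¹(A, 𝒯_A) = h¹(A, 𝒪_A) · dim A = g²`, the dimension of the space of first-order deformations of `A`
as a variety. [cite: MumfordAV1970, §13 Cor. 2 (p. 129) and §4 (iii) (p. 42)] [cite: Hartshorne1977, III Thm. 4.5 (p. 222)] -/
theorem AbelianVariety.finrank_cechMH1_tangentSheaf_eq_dim_sq
    (A₀ : Literature.AlgebraicGeometry.Motives.AbelianVariety ℂ) {κ : Type} [Finite κ]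
    (U : κ → A₀.X.left.Opens) (hU : ∀ i, IsAffineOpen (U i)) (hUcov : iSup U = ⊤) :
    Module.Finite ℂ (CechMH1 A₀.X.hom (tangentSheaf A₀.X) U) ∧
      Module.finrank ℂ (CechMH1 A₀.X.hom (tangentSheaf A₀.X) U) = A₀.dim ^ 2 := by
  obtain ⟨hfin, heq⟩ := AbelianVariety.finrank_cechH1_structureSheaf_eq_dim A₀ U hU hUcov
  haveI := hfin
  obtain ⟨e⟩ := Literature.AlgebraicGeometry.Motives.AbelianVariety.nonempty_tangentSheaf_iso_free A₀
  obtain ⟨h1, h2⟩ := finrank_cechMH1_of_iso_free A₀.X.hom U e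
  exact ⟨h1, by rw [h2, heq, Nat.card_eq_fintype_card, Fintype.card_fin, sq]⟩

end Literature.AlgebraicGeometry.HodgeTheory

end
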